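import Literature.NumberTheory.LFunctions.WeilGroundState
import Literature.NumberTheory.LFunctions.WeilGroundStateRealZerosProofs
import Literature.NumberTheory.LFunctions.WeilSemilocalCompactnessProofs
import HarnessLib

/-!
# Route WeilGroundState — crux `GroundStateSimpleEven` (stmt-RiemannHypothesis-1526), COMPACT step

Support file for line `parity-multiplicity-commutator` of the crux `∀ a > 0, WeilWindowSimpleEven a`:
the functional-analytic input `stub_evenGroundState_of_constrainedMinimisers` (COMPACT). At a window
`a > 0` and for a constraint vector `w ∈ L²`: if for every `δ > 0` there is an `L²`-normalised EVEN
window test function `g` with `∫ conj w · g = 0` and `Re Q(g) < ε(a) + δ`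
(`Q = weilQuadratic`, `ε(a) = weilGroundEnergy a`), then there is an EVEN ground state `u`
(`Literature.NumberTheory.LFunctions.IsWeilGroundState a u`, everywhere even) with `∫ conj w · u = 0`.

Proof. Choose `gₙ` with `δ = 1/(n+1)`; since `Re Q ≥ ε(a)` on the unit sphere of the window
(`ConnesVanSuijlekom.weilGroundEnergy_mul_le_re`), `Re Q(gₙ) → ε(a)`, so the form values are bounded and
the PROVED compactness fact `ConnesConsaniMoscovici2025_thm_3_6_holds` (Connes–Consani–Moscovici 2025,
Thm. 3.6, sequential form) gives a subsequence `g ∘ φ → u'` in `L²`. The symmetrisation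
`u = (u' + u'(-·))/2` is even, square integrable (Lebesgue measure is invariant under `t ↦ -t`), and
`∫ |gₙ − u|² ≤ ∫ |gₙ − u'|²` for even `gₙ` (convexity of `|·|²` and the reflection `t ↦ -t`), so
`g ∘ φ → u` in `L²` as well and `u` is a ground state. The constraint passes to the limit by continuity
of the `L²` pairing (`ConnesVanSuijlekom.tendsto_integral_mul_conj_left`, Cauchy–Schwarz).

Mathlib + the cited Literature files only.
-/

noncomputable section

open Set MeasureTheory Filter
open scoped Real Topology ComplexConjugate

namespace Summit.RiemannHypothesis.RiemannHypothesis.Theorems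

open Literature.NumberTheory.LFunctions

-- `linter.dupNamespace` is switched off per declaration: the mandated namespace
-- `Summit.RiemannHypothesis.RiemannHypothesis.Theorems` (single-problem summit) repeats a component.
set_option linter.dupNamespace false in
/-- Convexity of `|·|²` at the midpoint: `‖(A + B)/2‖² ≤ (‖A‖² + ‖B‖²)/2` for complex `A, B`
(triangle inequality and `2xy ≤ x² + y²`). [folklore] -/
private theorem norm_add_div_two_sq_le (A B : ℂ) :
    ‖(A + B) / 2‖ ^ 2 ≤ (‖A‖ ^ 2 + ‖B‖ ^ 2) / 2 := by
  have h1 : ‖(A + B) / 2‖ ≤ (‖A‖ + ‖B‖) / 2 := by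
    rw [norm_div, Complex.norm_two]
    exact div_le_div_of_nonneg_right (norm_add_le A B) zero_le_two
  have h2 : 0 ≤ ‖(A + B) / 2‖ := norm_nonneg _
  nlinarith [sq_nonneg (‖A‖ - ‖B‖), norm_nonneg A, norm_nonneg B, mul_self_le_mul_self h2 h1]

set_option linter.dupNamespace false in
/-- Square integrability is invariant under the reflection `t ↦ -t` (Lebesgue measure on `ℝ` is
negation invariant, `Measure.measurePreserving_neg`). [folklore] -/
private theorem memLp_two_comp_neg {u : ℝ → ℂ} (hu : MemLp u 2) : MemLp (fun t ↦ u (-t)) 2 :=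
  hu.comp_measurePreserving (Measure.measurePreserving_neg (volume : Measure ℝ))

set_option linter.dupNamespace false in
/-- **Symmetrising the limit does not increase the distance to an even function.** For `g` even and
`g, u' ∈ L²`: `∫ |g − (u' + u'(-·))/2|² ≤ ∫ |g − u'|²` (pointwise
`|g(t) − u(t)|² ≤ (|g(t) − u'(t)|² + |g(-t) − u'(-t)|²)/2` by evenness of `g` and convexity, then
`∫ F(-t) dt = ∫ F(t) dt`). [folklore] -/
private theorem integral_norm_sq_sub_symm_le {g u' : ℝ → ℂ} (hg : MemLp g 2) (hu' : MemLp u' 2)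
    (hev : ∀ t, g (-t) = g t) :
    ∫ t, ‖g t - (u' t + u' (-t)) / 2‖ ^ 2 ≤ ∫ t, ‖g t - u' t‖ ^ 2 := by
  set G : ℝ → ℂ := fun t ↦ g t - u' t with hGdef
  have hG : MemLp G 2 := hg.sub hu'
  have hGi : Integrable fun t ↦ ‖G t‖ ^ 2 := (memLp_two_iff_integrable_sq_norm hG.1).1 hG
  have hGin : Integrable fun t ↦ ‖G (-t)‖ ^ 2 := hGi.comp_neg
  have hpt : ∀ t, ‖g t - (u' t + u' (-t)) / 2‖ ^ 2 ≤ (‖G t‖ ^ 2 + ‖G (-t)‖ ^ 2) / 2 := by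
    intro t
    have e : g t - (u' t + u' (-t)) / 2 = (G t + G (-t)) / 2 := by
      simp only [hGdef, hev t]
      ring
    rw [e]
    exact norm_add_div_two_sq_le _ _
  calc ∫ t, ‖g t - (u' t + u' (-t)) / 2‖ ^ 2
      ≤ ∫ t, (‖G t‖ ^ 2 + ‖G (-t)‖ ^ 2) / 2 :=
        integral_mono_of_nonneg (ae_of_all _ fun t ↦ by positivity)
          ((hGi.add hGin).div_const 2) (ae_of_all _ hpt)
    _ = ((∫ t, ‖G t‖ ^ 2) + ∫ t, ‖G (-t)‖ ^ 2) / 2 := by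
        rw [integral_div, integral_add hGi hGin]
    _ = ∫ t, ‖G t‖ ^ 2 := by
        have h1 : ∫ t, ‖G (-t)‖ ^ 2 = ∫ t, ‖G t‖ ^ 2 :=
          integral_neg_eq_self (fun t ↦ ‖G t‖ ^ 2) volume
        rw [h1]
        ring

set_option linter.dupNamespace false in
/-- **COMPACT (even-sector compactness under one linear constraint).** Let `a > 0` and `w ∈ L²`. If
for every `δ > 0` there is an `L²`-normalised EVEN window test function `g` with `∫ conj w · g = 0`
and `Re Q(g) < ε(a) + δ`, then there is an EVEN ground state `u` at window `a`
(`IsWeilGroundState a u`, everywhere even) with `∫ conj w · u = 0`. Proof: choose `gₙ` with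
`δ = 1/(n+1)`; `Re Q(gₙ) → ε(a)` (it is `≥ ε(a)` on the sphere,
`ConnesVanSuijlekom.weilGroundEnergy_mul_le_re`); Connes–Consani–Moscovici 2025 Thm. 3.6
(`ConnesConsaniMoscovici2025_thm_3_6_holds`, proved in the tree) gives an `L²`-convergent
subsequence with limit `u'`; replace `u'` by its even part `(u' + u'(-·))/2`, to which the even
subsequence still converges (`integral_norm_sq_sub_symm_le`); the constraint passes to the limit by
Cauchy–Schwarz (`ConnesVanSuijlekom.tendsto_integral_mul_conj_left`). [folklore] -/
theorem stub_evenGroundState_of_constrainedMinimisers :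
    ∀ a : ℝ, 0 < a → ∀ w : ℝ → ℂ, MemLp w 2 →
      (∀ δ : ℝ, 0 < δ → ∃ g : ℝ → ℂ, IsWeilTest g ∧ tsupport g ⊆ Icc (-a) a ∧
        ∫ t, ‖g t‖ ^ 2 = (1 : ℝ) ∧ (∀ t, g (-t) = g t) ∧ ∫ t, starRingEnd ℂ (w t) * g t = 0 ∧
        (weilQuadratic g).re < weilGroundEnergy a + δ) →
      ∃ u : ℝ → ℂ, IsWeilGroundState a u ∧ (∀ t, u (-t) = u t) ∧
        ∫ t, starRingEnd ℂ (w t) * u t = 0 := by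
  intro a ha w hw hnear
  -- (1) a minimising sequence of even, normalised, constrained window test functions
  have hseq : ∀ n : ℕ, ∃ g : ℝ → ℂ, IsWeilTest g ∧ tsupport g ⊆ Icc (-a) a ∧
      ∫ t, ‖g t‖ ^ 2 = (1 : ℝ) ∧ (∀ t, g (-t) = g t) ∧ ∫ t, starRingEnd ℂ (w t) * g t = 0 ∧
      (weilQuadratic g).re < weilGroundEnergy a + 1 / ((n : ℝ) + 1) :=
    fun n ↦ hnear _ (by positivity)
  choose g hg hsupp hnorm hev horth hQlt using hseq
  have hQge : ∀ n, weilGroundEnergy a ≤ (weilQuadratic (g n)).re := fun n ↦ by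
    have h := ConnesVanSuijlekom.weilGroundEnergy_mul_le_re (hg n) (hsupp n)
    rwa [hnorm n, mul_one] at h
  have hQ : Tendsto (fun n ↦ (weilQuadratic (g n)).re) atTop (𝓝 (weilGroundEnergy a)) := by
    have h1 : Tendsto (fun n : ℕ ↦ weilGroundEnergy a + 1 / ((n : ℝ) + 1)) atTop
        (𝓝 (weilGroundEnergy a)) := by
      have h := (tendsto_one_div_add_atTop_nhds_zero_nat (𝕜 := ℝ)).const_add (weilGroundEnergy a)
      rwa [add_zero] at h
    exact tendsto_of_tendsto_of_tendsto_of_le_of_le tendsto_const_nhds h1 hQge fun n ↦ (hQlt n).le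
  -- (2) compactness of the form embedding (CCM25 Thm. 3.6): an `L²`-convergent subsequence
  obtain ⟨u', hu', φ, hφ, hconv⟩ := ConnesConsaniMoscovici2025_thm_3_6_holds a ha g
    (fun n ↦ ⟨hg n, hsupp n, hnorm n⟩) hQ.bddAbove_range
  -- (3) symmetrise the limit
  have hu'n : MemLp (fun t ↦ u' (-t)) 2 := memLp_two_comp_neg hu'
  have hu : MemLp (fun t ↦ (u' t + u' (-t)) / 2) 2 := by
    have h := (hu'.add hu'n).const_mul (1 / 2 : ℂ)
    have e : (fun t ↦ (u' t + u' (-t)) / 2) = fun x ↦ (1 / 2 : ℂ) * (u' + fun t ↦ u' (-t)) x := by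
      funext t
      simp only [Pi.add_apply]
      ring
    rw [e]
    exact h
  have hconv' : Tendsto (fun n ↦ ∫ t, ‖g (φ n) t - (u' t + u' (-t)) / 2‖ ^ 2) atTop (𝓝 0) :=
    squeeze_zero (fun n ↦ integral_nonneg fun _ ↦ by positivity)
      (fun n ↦ integral_norm_sq_sub_symm_le (ConnesVanSuijlekom.isWeilTest_memLp (hg (φ n))) hu'
        (hev (φ n))) hconv
  refine ⟨fun t ↦ (u' t + u' (-t)) / 2,
    ⟨hu, fun n ↦ g (φ n), fun n ↦ ⟨hg (φ n), hsupp (φ n), hnorm (φ n)⟩, hQ.comp hφ.tendsto_atTop,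
      hconv'⟩, fun t ↦ ?_, ?_⟩
  · -- (4) evenness
    simp only [neg_neg]
    ring
  · -- (5) the constraint passes to the limit
    have hlim := ConnesVanSuijlekom.tendsto_integral_mul_conj_left hw hu
      (fun m ↦ ConnesVanSuijlekom.isWeilTest_memLp (hg (φ m))) hconv'
    have hzero : ∀ m, ∫ t, g (φ m) t * conj (w t) = 0 := fun m ↦ by
      simp_rw [mul_comm (g (φ m) _)]
      exact horth (φ m)
    simp only [hzero] at hlim
    have h0 : ∫ t, (u' t + u' (-t)) / 2 * conj (w t) = 0 :=
      tendsto_nhds_unique hlim tendsto_const_nhds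
    simp_rw [mul_comm (starRingEnd ℂ (w _))]
    exact h0

end Summit.RiemannHypothesis.RiemannHypothesis.Theorems

end
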